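import Literature.Topology.FourManifolds.ZeroSurgeryHomotopyBallSlicePi1
import Literature.Topology.FourManifolds.ZeroSurgeryHomotopyBallSliceHomology
import Literature.Topology.FourManifolds.SliceDiscConicalFramingExistence
import Literature.Topology.FourManifolds.SPC4Wave0Proofs
import HarnessLib

/-!
# Manolescu–Piccirillo Lemma 3.3 for `W = S⁴`: the discharges

Topic `Literature/Topology/FourManifolds`; fact item `provefact-Literature.Topology.FourManifolds.Knot.M-9195998579`
(the named fact `Literature.Topology.FourManifolds.Knot.ManolescuPiccirillo2023_lemma33_sphere_core`,
`ZeroSurgeryHomotopyBallSliceProofs.lean`: C. Manolescu, L. Piccirillo, *From zero surgeries to candidates for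
exotic definite 4-manifolds*, J. Lond. Math. Soc. (2) 108 (2023), §3.2, proof of Lemma 3.3 for `W = S⁴` —
everything but Whitehead's theorem: knots `K, K'` with a common `0`-surgery, `K` smoothly slice ⇒ a closed
smooth simply connected `4`-manifold `X` with `H₂(X; ℤ) = 0` in which `K'` bounds a smooth proper disc off a
ball).

Every leaf of the decomposition of Lemma 3.3 (`W = S⁴`) set up in `ZeroSurgeryHomotopyBallSliceProofs.lean` and
`ZeroSurgeryHomotopyBallSliceConstruction.lean` is now a theorem of the tree:

* (T) the collared open trace — `Knot.exists_openTrace_of_isIntegralSurgery_holds` (`OpenTraceCollar.lean`);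
* (V) the collared end of the slice-disc exterior — `Knot.IsSliceDisc.exists_endCollar_of_isIntegralSurgery_zero_of_facts`
  (`SliceDiscEndCollar.lean`) from the conical straightening `Knot.IsSliceDisc.exists_conical_diffeomorph_holds`
  (`SliceDiscEndCollarFactsProofs.lean`) and the framed conical tube
  `Knot.IsSliceDisc.exists_conicalTube_hasFraming_zero_holds` (`SliceDiscConicalFramingExistence.lean`);
* `π₁(X) = 1` for the glued manifold — `simplyConnectedSpace_ofCollars_sliceDiscExterior` inside
  `Knot.ManolescuPiccirillo2023_lemma33_sphere_core_of_endCollar` (`ZeroSurgeryHomotopyBallSlicePi1.lean`;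
  independently `MPGlue.simplyConnectedSpace_glued`, `ZeroSurgeryHomotopyBallSliceGluing.lean`);
* `H₂(X; ℤ) = 0` — `Knot.isZero_singularHomologyZ_two_of_isSliceDiscIn_of_range_eq_holds`
  (`ZeroSurgeryHomotopyBallSliceHomology.lean`);
* the recognition of homotopy `4`-spheres (`spc4.S10`) — `nonempty_homotopyEquiv_sphere_four_iff_holds`
  (`SPC4Wave0Proofs.lean`).

This file only composes them:

* `Knot.IsSliceDisc.exists_endCollar_of_isIntegralSurgery_zero_holds` — discharge of (V);
* `Knot.ManolescuPiccirillo2023_lemma33_sphere_construction_holds` — discharge of the construction step `CONSTR`;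
* **`Knot.ManolescuPiccirillo2023_lemma33_sphere_core_holds`** — discharge of the core (this fact item);
* **`Knot.ManolescuPiccirillo2023_lemma33_sphere_holds`** — discharge of Manolescu–Piccirillo's Lemma 3.3 for
  `W = S⁴` itself (`ZeroSurgeryHomotopyBallSlice.lean`), unconditionally.

## References

* C. Manolescu, L. Piccirillo, J. Lond. Math. Soc. (2) 108 (2023) 2001–2036, §3.2, Lemma 3.3 and its proof,
  Def. 3.4 (arXiv:2102.04391: Lemma 3.5, Def. 3.6). [ManolescuPiccirillo2023]

## Design notes

* No definitions, no named facts, no `sorry`; the discharges have exactly the types of the named facts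
  (`theorem X_holds : X`).
-/

noncomputable section

namespace Literature.Topology.FourManifolds

namespace Knot

/-- **Discharge of leaf (V)**: the end of the open slice-disc exterior `B̊⁴ ∖ Δ` is collared by the `0`-surgery
(`ZeroSurgeryHomotopyBallSliceConstruction.lean`), from the conical straightening and the framed conical tube,
both proved. [cite: ManolescuPiccirillo2023, §3.2, proof of Lemma 3.3] -/
theorem IsSliceDisc.exists_endCollar_of_isIntegralSurgery_zero_holds :
    IsSliceDisc.exists_endCollar_of_isIntegralSurgery_zero :=
  IsSliceDisc.exists_endCollar_of_isIntegralSurgery_zero_of_facts IsSliceDisc.exists_conical_diffeomorph_holds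
    IsSliceDisc.exists_conicalTube_hasFraming_zero_holds

/-- **Discharge of the construction step `CONSTR`** of the printed proof: the closed smooth `X = X(K') ∪_Y V`
with its ball, proper disc for `K'` and the open embedding of `B̊⁴ ∖ Δ` onto their complement, glued from the two
collars (T), (V). [cite: ManolescuPiccirillo2023, §3.2, proof of Lemma 3.3 and Definition 3.4] -/
theorem ManolescuPiccirillo2023_lemma33_sphere_construction_holds :
    ManolescuPiccirillo2023_lemma33_sphere_construction :=
  ManolescuPiccirillo2023_lemma33_sphere_construction_of_collars exists_openTrace_of_isIntegralSurgery_holds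
    IsSliceDisc.exists_endCollar_of_isIntegralSurgery_zero_holds

/-- **Discharge of the named fact `ManolescuPiccirillo2023_lemma33_sphere_core`** (Manolescu–Piccirillo (2023),
proof of Lemma 3.3 for `W = S⁴`, everything but Whitehead's theorem): if `K, K'` have a common `0`-surgery and
`K` is smoothly slice, then there is a closed smooth simply connected `4`-manifold `X` with `H₂(X; ℤ) = 0` in which
`K'` bounds a smooth proper disc off a ball — by `ManolescuPiccirillo2023_lemma33_sphere_core_of_endCollar`
(the glued `X(K') ∪_Y V` with `π₁ = 1`, `ZeroSurgeryHomotopyBallSlicePi1.lean`) fed with the proved end collar (V)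
and the proved homology leaf `isZero_singularHomologyZ_two_of_isSliceDiscIn_of_range_eq_holds`.
[cite: ManolescuPiccirillo2023, §3.2, proof of Lemma 3.3] -/
theorem ManolescuPiccirillo2023_lemma33_sphere_core_holds : ManolescuPiccirillo2023_lemma33_sphere_core :=
  ManolescuPiccirillo2023_lemma33_sphere_core_of_endCollar IsSliceDisc.exists_endCollar_of_isIntegralSurgery_zero_holds
    isZero_singularHomologyZ_two_of_isSliceDiscIn_of_range_eq_holds

/-- **Discharge of Manolescu–Piccirillo's Lemma 3.3 for `W = S⁴`** (the named fact
`ManolescuPiccirillo2023_lemma33_sphere`, `ZeroSurgeryHomotopyBallSlice.lean`): if `K, K' ⊂ S³` have a common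
`0`-surgery `Y` and `K` is smoothly slice, then `K'` bounds a smooth proper disc in `Σ ∖ B̊⁴` for some closed
smooth `4`-manifold `Σ ≃ S⁴` — the core together with the recognition of homotopy `4`-spheres by `π₁ = 1`,
`H₂ = 0` (`nonempty_homotopyEquiv_sphere_four_iff_holds`, the Whitehead-theorem step of the source).
[cite: ManolescuPiccirillo2023, §3.2, Lemma 3.3] -/
theorem ManolescuPiccirillo2023_lemma33_sphere_holds : ManolescuPiccirillo2023_lemma33_sphere :=
  ManolescuPiccirillo2023_lemma33_sphere_of_core ManolescuPiccirillo2023_lemma33_sphere_core_holds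
    nonempty_homotopyEquiv_sphere_four_iff_holds

end Knot

end Literature.Topology.FourManifolds
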